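import Summits.ValiantsHypothesis.ValiantsHypothesis.Theses.GrenetZeon
import Literature.Computability.AlgebraicComplexity.LayeredABPScalarRestriction
import Literature.Computability.AlgebraicComplexity.AlgDetRepr
import HarnessLib

/-!
# Crux `GrenetZeon.AbelianizationQP` (stmt-ValiantsHypothesis-8063), line `zeon-window` —
# the MECHANISM LEMMA: commuting transition structure abelianizes for free

`AbelianizationQP` asks to trade the SIZE `m` of an affine determinantal representation of `per_n`
for a commutative coefficient algebra of dimension `2^((log₂ m + c)^c)` on a matrix of polynomial
size `n^c + c`.  Every abelianization known to the route (Grenet's `2^n − 1` program ↦ the `n × n`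
zeon determinant, Landsberg–Ressayre ↦ the apolar algebra of `det_n`) is an instance of ONE
mechanism, typed here in general:

* `hasAlgDetRepr_entry_prod_of_algHom` — let `R` be a commutative `K`-algebra of dimension `≤ s`
  and `ρ : R →ₐ[K] Mat_β(K)` an algebra map.  If `L_1, …, L_d ∈ R[x]` are affine, then every ENTRY of
  the iterated product `ρ(L_1) ⋯ ρ(L_d)` of the corresponding `β × β` matrices of affine forms over
  `K` (coefficient matrices `ρ`(coefficients)) has a `(d, s)`-representation: the DIAGONAL
  `d × d` matrix `diag(L_1, …, L_d)` over `R`, read through the functional `r ↦ ρ(r)_{ab}`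
  (`det diag = ∏ L_k`, and `ρ` applied coefficientwise is multiplicative —
  `LayeredABPComputes.mapEntry_mul`, the Hrubeš–Yehudayoff simulation read backwards).
* `hasAlgDetRepr_entry_prod_of_commute` — hence: an entry of a product of `d` affine matrix pencils
  `M_k(x) = B₀(k) + Σ_t x_t B(k,t)` of width `w = |β|` whose coefficient matrices `B₀(k), B(k,t)`
  PAIRWISE COMMUTE is a `(d, w²)`-representation — the coefficient algebra is the (commutative,
  `Algebra.isMulCommutative_adjoin`) subalgebra of `Mat_w(K)` they generate, of dimension `≤ w²`.
  Width is traded for coefficient dimension at no cost in matrix size exactly when the bookkeeping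
  commutes (Grenet: the subset-insertion operators `z_j : S ↦ S ∪ {j}` commute and square to zero —
  the zeon algebra; an `(n, 4^n)`-representation of `per_n` results, cf. the proved zeon point
  `(n, 2^n)`).

Reading for the crux (honest): `AbelianizationQP` in the window `n^c + c < m < 2^(n^{1/c})` would
follow from a RE-EXPRESSION theorem "every width-`m` affine determinantal representation of `per_n`
yields an iterated product of `n^c + c` affine pencils of width `2^{((log₂ m + c)^c)/2}` with pairwise
commuting coefficients"; the obstruction named in the route text (Nisan 1991; Hrubeš–Yehudayoff 2011
Thm. 3.4: genuinely noncommutative transition structure) is exactly the failure of the commutation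
hypothesis, which this file does not touch.  Nothing here is progress on the crux or on VP ≠ VNP.
Axioms `propext`, `Classical.choice`, `Quot.sound`.

## References
* P. Hrubeš, A. Yehudayoff, *Arithmetic complexity in ring extensions*, Theory of Computing 7
  (2011), §4 (simulation of a commutative extension by matrices). [HrubesYehudayoff2011]
* B. Grenet, *An upper bound for the permanent versus determinant problem* (2011), Thm. 1.
  [Grenet2011]
* C. Brand, H. Dell, T. Husfeldt, *Extensor-coding*, STOC 2018, §3. [BrandDellHusfeldt2018]
-/

set_option linter.dupNamespace false

noncomputable section

namespace Summit.ValiantsHypothesis.ValiantsHypothesis.Theorems.GrenetZeonAbelianizationQP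

open MvPolynomial Matrix
open Literature.Computability.AlgebraicComplexity

variable {K : Type} [Field K] {ι : Type} {β : Type} [Fintype β] [DecidableEq β]

section Core

variable {R : Type} [CommRing R] [Algebra K R] (ρ : R →ₐ[K] Matrix β β K)

/-- The matrix of coefficientwise `ρ`-entries of `1 ∈ R[x]` is the identity matrix over `K[x]`.
[folklore] -/
theorem of_mapEntry_one :
    (Matrix.of fun i j => (AddMonoidAlgebra.map
        ((Matrix.entryAddMonoidHom K i j).comp (ρ : R →+* Matrix β β K).toAddMonoidHom)
        (1 : MvPolynomial ι R) : MvPolynomial ι K)) = 1 := by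
  classical
  refine Matrix.ext fun i j => MvPolynomial.ext _ _ fun d => ?_
  rw [Matrix.of_apply]
  show (Matrix.entryAddMonoidHom K i j) ((ρ : R →+* Matrix β β K) (coeff d (1 : MvPolynomial ι R)))
    = coeff d ((1 : Matrix β β (MvPolynomial ι K)) i j)
  rw [coeff_one, Matrix.entryAddMonoidHom_apply]
  by_cases hij : i = j
  · subst hij
    rw [Matrix.one_apply_eq, coeff_one]
    split_ifs
    · rw [map_one, Matrix.one_apply_eq]
    · rw [map_zero, Matrix.zero_apply]
  · rw [Matrix.one_apply_ne hij, coeff_zero]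
    split_ifs
    · rw [map_one, Matrix.one_apply_ne hij]
    · rw [map_zero, Matrix.zero_apply]

/-- **Multiplicativity along a list**: the matrix of coefficientwise `ρ`-entries of a product
`p_1 ⋯ p_r ∈ R[x]` is the product of the matrices of the factors (`LayeredABPComputes.mapEntry_mul`
iterated). [cite: HrubesYehudayoff2011, §4] -/
theorem of_mapEntry_list_prod (ps : List (MvPolynomial ι R)) :
    (Matrix.of fun i j => (AddMonoidAlgebra.map
        ((Matrix.entryAddMonoidHom K i j).comp (ρ : R →+* Matrix β β K).toAddMonoidHom)
        ps.prod : MvPolynomial ι K)) =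
      (ps.map fun p => Matrix.of fun i j => (AddMonoidAlgebra.map
        ((Matrix.entryAddMonoidHom K i j).comp (ρ : R →+* Matrix β β K).toAddMonoidHom)
        p : MvPolynomial ι K)).prod := by
  induction ps with
  | nil => rw [List.prod_nil, List.map_nil, List.prod_nil, of_mapEntry_one]
  | cons p ps ih =>
    rw [List.prod_cons, List.map_cons, List.prod_cons, ← ih]
    refine Matrix.ext fun i j => ?_
    rw [Matrix.of_apply, LayeredABPComputes.mapEntry_mul, Matrix.mul_apply]
    rfl

/-- **Mechanism lemma, algebra-map form.** Let `R` be a commutative `K`-algebra, finite over `K`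
with `finrank ≤ s`, `ρ : R →ₐ[K] Mat_β(K)` an algebra map, and `L_1, …, L_d ∈ R[x]` affine forms.
Then every entry `(a, b)` of the iterated product of the `β × β` matrices of affine forms over `K`
obtained from the `L_k` by taking `ρ`-entries coefficientwise has a `(d, s)`-representation: the
diagonal matrix `diag(L_1, …, L_d)` over `R` read through `r ↦ ρ(r)_{ab}` (`det diag = ∏ L_k`;
coefficientwise `ρ` is multiplicative, `of_mapEntry_list_prod`). [cite: HrubesYehudayoff2011, §4] -/
theorem hasAlgDetRepr_entry_prod_of_algHom [Module.Finite K R] {s : ℕ}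
    (hR : Module.finrank K R ≤ s) {d : ℕ} (L : Fin d → MvPolynomial ι R)
    (hL : ∀ k, (L k).totalDegree ≤ 1) (a b : β) :
    HasAlgDetRepr
      (((List.ofFn fun k => Matrix.of fun i j => (AddMonoidAlgebra.map
          ((Matrix.entryAddMonoidHom K i j).comp (ρ : R →+* Matrix β β K).toAddMonoidHom)
          (L k) : MvPolynomial ι K)).prod) a b)
      d s := by
  classical
  refine HasAlgDetRepr.of_data R hR ((Matrix.entryLinearMap K K a b).comp ρ.toLinearMap)
    (Matrix.diagonal L) (fun i j => ?_) (fun e => ?_)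
  · rw [Matrix.diagonal_apply]
    split_ifs
    · exact hL i
    · rw [totalDegree_zero]; exact Nat.zero_le _
  · have h := congrFun (congrFun (of_mapEntry_list_prod ρ (List.ofFn L)) a) b
    rw [List.map_ofFn, Matrix.of_apply, List.prod_ofFn] at h
    rw [Matrix.det_diagonal]
    -- `h : (ρ ∘ coeff)_{ab} (∏ L) = ((List.ofFn _).prod) a b`, coefficientwise
    have hcoeff := congrArg (MvPolynomial.coeff e) h
    simp only [Function.comp_def] at hcoeff
    rw [← hcoeff]
    rfl

end Core

/-- The subalgebra generated by a pairwise commuting set of `w × w` matrices has dimension `≤ w²`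
(it is a subspace of `Mat_w(K)`). [folklore] -/
theorem finrank_adjoin_matrix_le (S : Set (Matrix β β K)) :
    Module.finrank K (Algebra.adjoin K S) ≤ Fintype.card β ^ 2 :=
  calc Module.finrank K (Algebra.adjoin K S)
      ≤ Module.finrank K (Matrix β β K) :=
        Submodule.finrank_le (Subalgebra.toSubmodule (Algebra.adjoin K S))
    _ = Fintype.card β ^ 2 := by
        rw [Module.finrank_matrix, Module.finrank_self, mul_one, sq]

/-- **Mechanism lemma (commuting transition structure abelianizes for free).** Let
`M_k(x) = B₀(k) + Σ_t x_t · B(k, t)` (`k < d`) be affine pencils of `w × w` matrices over a field `K`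
whose coefficient matrices `B₀(k), B(k, t)` PAIRWISE COMMUTE.  Then every entry `(a, b)` of the
iterated product `M_1(x) ⋯ M_d(x)` has a `(d, w²)`-representation (`HasAlgDetRepr`): it is
`λ(det diag(L_1, …, L_d))` for the affine forms `L_k = B₀(k) + Σ_t x_t B(k,t)` with coefficients in
the COMMUTATIVE subalgebra `R ⊆ Mat_w(K)` generated by the coefficient matrices (`dim R ≤ w²`) and
`λ(r) = r_{ab}`.  Grenet's `2^n − 1` program for `per_n` is the case where the `B(k, (k, j))` are the
commuting square-zero subset-insertion operators (zeons).  [cite: HrubesYehudayoff2011, §4] -/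
theorem hasAlgDetRepr_entry_prod_of_commute [Fintype ι] [DecidableEq ι] {d : ℕ}
    (B₀ : Fin d → Matrix β β K) (B : Fin d → ι → Matrix β β K)
    (hcomm : ∀ x ∈ Set.range B₀ ∪ Set.range (Function.uncurry B),
      ∀ y ∈ Set.range B₀ ∪ Set.range (Function.uncurry B), x * y = y * x)
    (a b : β) :
    HasAlgDetRepr
      (((List.ofFn fun k : Fin d => Matrix.of fun i j =>
          (C (B₀ k i j) + ∑ t, C (B k t i j) * X t : MvPolynomial ι K)).prod) a b)
      d (Fintype.card β ^ 2) := by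
  classical
  set S : Set (Matrix β β K) := Set.range B₀ ∪ Set.range (Function.uncurry B) with hS
  haveI hc : IsMulCommutative (Algebra.adjoin K S) := Algebra.isMulCommutative_adjoin K hcomm
  letI : CommRing (Algebra.adjoin K S) :=
    { (inferInstance : Ring (Algebra.adjoin K S)) with mul_comm := mul_comm' }
  have hB₀ : ∀ k, B₀ k ∈ Algebra.adjoin K S := fun k =>
    Algebra.subset_adjoin (Or.inl ⟨k, rfl⟩)
  have hB : ∀ k t, B k t ∈ Algebra.adjoin K S := fun k t =>
    Algebra.subset_adjoin (Or.inr ⟨(k, t), rfl⟩)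
  -- the affine forms over the commutative algebra
  set L : Fin d → MvPolynomial ι (Algebra.adjoin K S) := fun k =>
    C ⟨B₀ k, hB₀ k⟩ + ∑ t, C ⟨B k t, hB k t⟩ * X t with hLdef
  have hL : ∀ k, (L k).totalDegree ≤ 1 := by
    intro k
    refine (totalDegree_add _ _).trans (max_le ?_ ?_)
    · rw [totalDegree_C]; exact Nat.zero_le _
    · refine (totalDegree_finsetSum _ _).trans (Finset.sup_le fun t _ => ?_)
      refine (totalDegree_mul _ _).trans ?_
      rw [totalDegree_C, zero_add]
      rcases subsingleton_or_nontrivial (Algebra.adjoin K S) with h0 | h1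
      · rw [Subsingleton.elim (X t : MvPolynomial ι (Algebra.adjoin K S)) 0, totalDegree_zero]
        exact Nat.zero_le _
      · rw [totalDegree_X]
  have key := hasAlgDetRepr_entry_prod_of_algHom (Algebra.adjoin K S).val
    (finrank_adjoin_matrix_le S) L hL a b
  -- identify the matrices of coefficientwise entries with the given pencils
  have hmat : (fun k : Fin d => Matrix.of fun i j => (AddMonoidAlgebra.map
      ((Matrix.entryAddMonoidHom K i j).comp
        ((Algebra.adjoin K S).val : Algebra.adjoin K S →+* Matrix β β K).toAddMonoidHom)
      (L k) : MvPolynomial ι K)) =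
      fun k : Fin d => Matrix.of fun i j =>
        (C (B₀ k i j) + ∑ t, C (B k t i j) * X t : MvPolynomial ι K) := by
    funext k
    refine Matrix.ext fun i j => MvPolynomial.ext _ _ fun e => ?_
    rw [Matrix.of_apply, Matrix.of_apply]
    show (Matrix.entryAddMonoidHom K i j)
        (((Algebra.adjoin K S).val : Algebra.adjoin K S →+* Matrix β β K) (coeff e (L k))) =
      coeff e (C (B₀ k i j) + ∑ t, C (B k t i j) * X t)
    simp only [hLdef, coeff_add, coeff_sum, coeff_C_mul, coeff_X, coeff_C, mul_ite, mul_one,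
      mul_zero, map_add, map_sum, Matrix.entryAddMonoidHom_apply]
    congr 1
    · split_ifs <;> simp
    · refine Finset.sum_congr rfl fun t _ => ?_
      split_ifs <;> simp
  rw [hmat] at key
  exact key

/-! ### Reading for the crux: a commuting re-expression theorem would give `AbelianizationQP` -/

open Summit.ValiantsHypothesis.ValiantsHypothesis.Theses.GrenetZeon in
/-- **What positive statement would settle the crux through this mechanism.** If, for some `c`,
every affine determinantal representation of `per_n` (`n ≥ 1`) of size `m` can be RE-EXPRESSED as an
entry of an iterated product of `d ≤ n^c + c` affine pencils of width `w` with `w² ≤ 2^((log₂ m + c)^c)`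
and pairwise commuting coefficient matrices, then `AbelianizationQP` holds with the same `c`
(`hasAlgDetRepr_entry_prod_of_commute` and padding, `HasAlgDetRepr.mono`).  The hypothesis is NOT
claimed; it is the commutation requirement that the route's "why it might fail" (Nisan 1991,
Hrubeš–Yehudayoff 2011 Thm. 3.4) says a generic representation may violate.
[cite: HrubesYehudayoff2011, §4] -/
theorem abelianizationQP_of_commutingReexpression {c : ℕ}
    (h : ∀ n m : ℕ, 1 ≤ n → HasDetRepr (perPoly (Fin n) ℂ) m →
      ∃ (d w : ℕ), d ≤ n ^ c + c ∧ w ^ 2 ≤ 2 ^ ((Nat.log 2 m + c) ^ c) ∧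
        ∃ (B₀ : Fin d → Matrix (Fin w) (Fin w) ℂ) (B : Fin d → Fin n × Fin n → Matrix (Fin w) (Fin w) ℂ)
          (_ : ∀ x ∈ Set.range B₀ ∪ Set.range (Function.uncurry B),
            ∀ y ∈ Set.range B₀ ∪ Set.range (Function.uncurry B), x * y = y * x)
          (a b : Fin w),
          perPoly (Fin n) ℂ =
            ((List.ofFn fun k : Fin d => Matrix.of fun i j =>
              (C (B₀ k i j) + ∑ t, C (B k t i j) * X t : MvPolynomial (Fin n × Fin n) ℂ)).prod) a b) :
    AbelianizationQP := by
  refine ⟨c, fun n m hn hdet => ?_⟩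
  obtain ⟨d, w, hd, hw, B₀, B, hcomm, a, b, hper⟩ := h n m hn hdet
  have hrep := hasAlgDetRepr_entry_prod_of_commute B₀ B hcomm a b
  rw [← hper, Fintype.card_fin] at hrep
  show HasAlgDetRepr (perPoly (Fin n) ℂ) (n ^ c + c) (2 ^ ((Nat.log 2 m + c) ^ c))
  exact hrep.mono hd hw

end Summit.ValiantsHypothesis.ValiantsHypothesis.Theorems.GrenetZeonAbelianizationQP

end
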